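import Summits.QuantumFields.YangMills.Theses.SlackWindow
import Summits.QuantumFields.YangMills.Theorems.SquareRootCeilingsMirrorDomination
import Summits.QuantumFields.YangMills.Theorems.SquareRootCeilingsDominationTransfer

/-!
# Route `SlackWindow` — the split glue `SlackSqrtGlue` (stmt-QuantumFields-23501), PROVED

`SlackSqrtGlue : SqrtDominationC → SlackMirrorCeiling → SlackCeilings` (gen-1 split of the crux `SlackCeilings`,
stmt-QuantumFields-23097, ym-idea-11 g10 LINE 1, lens «wuc»).

Proof.  Fix the floor datum and a live level; `SlackMirrorCeiling` gives `σ, C₁, ℓ₄, β₄` with the slack ceiling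
`b := (C₁/R⁴·((R s)⁻¹)^σ)²` on every same-orientation TIME-AXIS mirror covariance `Cov_T(P_q(t e₀), P_q(0))`,
`2R+2 ≤ t ≤ L`; reflection positivity of the torus state (the landed, bound-agnostic
`MirrorDomination.abs_cov_le_of_axisMirror`, any `B`, `β ≥ 0`) makes `b` a bound on EVERY `(2R+4)`-separated
single-plane pair; the uniform-envelope form of `SqrtDomination` (stmt-QuantumFields-26902) cashes it as
`(C₂ n^θ √b)ⁿ = (C₂C₁ n^θ/R⁴·((Rs)⁻¹)^σ)ⁿ` for `n ≥ 2`; `n = 0` (`E 1 = 1`) and `n = 1` (a centred one-point function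
vanishes) are trivial — verbatim the pattern of `SquareRootCeilings.dominationTransfer_proof` with the slack factor
threaded.  Also the by-name edge `slackMirrorCeiling_of_axisMirror` (σ = 0): `SquareRootCeilings.AxisMirrorCeiling`
(stmt-QuantumFields-26791) ⇒ `SlackMirrorCeiling`.

HONEST LABEL: glue only.  The cruxes `SlackMirrorCeiling` (stmt-QuantumFields-23500) and `SqrtDomination`
(stmt-QuantumFields-26902) stay OPEN; no summit, leaf (R2a-IV) or NT statement is proved here; the YM mass gap is NOT
proved.  Planner ym-idea-11 g10.

References: K. Osterwalder, E. Seiler, Ann. Phys. 110 (1978) 440 (§2, reflection positivity of lattice gauge theory);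
J. Fröhlich, R. Israel, E. Lieb, B. Simon, CMP 62 (1978) 1 (Thm. 2.1).
-/

set_option autoImplicit false

noncomputable section

namespace Summit.QuantumFields.YangMills.Theorems.SlackWindow

open MeasureTheory
open Literature.MathematicalPhysics.QuantumFieldTheory Literature.MathematicalPhysics.QuantumLattice
open Summit.QuantumFields.YangMills.Cruxes.OSLegsFromFemtoAndGap.DlrCollarTransfer
open Summit.QuantumFields.YangMills.Theses.SlackWindow (SqrtDominationC SlackMirrorCeiling SlackCeilings SlackSqrtGlue)

/-- The glue is a theorem: RP mirror domination (`MirrorDomination.abs_cov_le_of_axisMirror`, any bound `B`) turns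
the slack mirror ceiling into the slack bound `b := (C₁/R⁴·((Rs)⁻¹)^σ)²` on every `(2R+4)`-separated single-plane
pair; `SqrtDomination` (uniform-envelope form) cashes it as `(C₂ n^θ √b)ⁿ`; `n = 0, 1` are trivial. -/
theorem slackSqrtGlue_proof : Summit.QuantumFields.YangMills.Theses.SlackWindow.SlackSqrtGlue := by
  intro hK2 hM G _ _ _ _ hG hSU
  letI : MeasurableSpace G := borel G
  haveI : BorelSpace G := ⟨rfl⟩
  intro r v f g h Λ₅
  obtain ⟨ε₀, hε₀, H1⟩ := hM G hG hSU r v f g h Λ₅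
  refine ⟨ε₀, hε₀, fun ε hε hεle hfl => ?_⟩
  obtain ⟨σ, C₁, ℓ₄, β₄, hℓ₄, hC₁, H1'⟩ := H1 ε hε hεle hfl
  obtain ⟨C₂, θ, β₄', hC₂, hθ, H2⟩ := hK2 G hG hSU r
  refine ⟨σ, C₂ * C₁, θ, ℓ₄, max (max β₄ β₄') 0, hℓ₄, mul_nonneg hC₂ hC₁, hθ, ?_⟩
  intro β hβ s hs hs1 hsub L n
  have hβ₁ : β₄ ≤ β := le_trans (le_trans (le_max_left _ _) (le_max_left _ _)) hβ
  have hβ₂ : β₄' ≤ β := le_trans (le_trans (le_max_right _ _) (le_max_left _ _)) hβ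
  have hβ0 : (0 : ℝ) ≤ β := le_trans (le_max_right _ _) hβ
  rcases n with _ | _ | m
  · -- n = 0 : empty product
    intro q x R _ _ _ _ _
    simp [Summit.QuantumFields.YangMills.Cruxes.UVSeamRec.ResponsePinning.torusE_const]
  · -- n = 1 : a centred one-point function vanishes
    intro q x R _ _ _ _ _
    have hslk : (0 : ℝ) ≤ (((R : ℝ) * s)⁻¹) ^ σ := pow_nonneg (inv_nonneg.mpr (by positivity)) _
    have h0 : (0 : ℝ) ≤ (C₂ * C₁ * (((0 + 1 : ℕ) : ℝ)) ^ θ / (R : ℝ) ^ 4 * (((R : ℝ) * s)⁻¹) ^ σ) ^ (0 + 1) := by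
      positivity
    simpa [Fin.prod_univ_one, Summit.QuantumFields.YangMills.Theses.SquareRootCeilings.torusE_plane_centred] using h0
  · -- n = m + 2 ≥ 2 : the mirror ceiling dominates every separated pair (RP), K2 gives the square-root gain
    intro q x R hq hR hRs hRL hsep
    set a : ℝ := C₁ / (R : ℝ) ^ 4 * (((R : ℝ) * s)⁻¹) ^ σ with ha
    have ha0 : 0 ≤ a := by
      have hslk : (0 : ℝ) ≤ (((R : ℝ) * s)⁻¹) ^ σ := pow_nonneg (inv_nonneg.mpr (by positivity)) _
      exact mul_nonneg (div_nonneg hC₁ (pow_nonneg (Nat.cast_nonneg _) _)) hslk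
    set b : ℝ := a ^ 2 with hb
    have hb0 : 0 ≤ b := sq_nonneg _
    -- the mirror ceiling along the time axis, read at this (β, s, L, R)
    have hmirror : ∀ (q₁ : Fin 4 × Fin 4) (t : ℕ), q₁.1 < q₁.2 → 2 * R + 2 ≤ t → t ≤ L →
        |torusE G r β L (fun U =>
            (plane G r q₁ (fun i => if i = 0 then ((t : ℕ) : ℤ) else 0) U -
                torusE G r β L (plane G r q₁ (fun i => if i = 0 then ((t : ℕ) : ℤ) else 0))) *
              (plane G r q₁ (fun _ => 0) U - torusE G r β L (plane G r q₁ (fun _ => 0))))| ≤ b :=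
      fun q₁ t hq₁ ht htL => H1' β hβ₁ s hs hs1 hsub L q₁ R t hq₁ hR hRs hRL ht htL
    -- RP mirror domination: every (2R+4)-separated single-plane pair obeys the same bound
    have hpairs : ∀ (q q' : Fin 4 × Fin 4) (x y : Fin 4 → ℤ), q.1 < q.2 → q'.1 < q'.2 →
        (∃ k : Fin 4, (2 * (R : ℤ) + 4) ≤ |((((x k - y k : ℤ) : ZMod (2 * L + 1))).valMinAbs : ℤ)|) →
        |torusE G r β L (fun U => (plane G r q x U - torusE G r β L (plane G r q x)) *
          (plane G r q' y U - torusE G r β L (plane G r q' y)))| ≤ b := by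
      intro q q' x y hq hq' hk
      obtain ⟨k, hk⟩ := hk
      exact Summit.QuantumFields.YangMills.Theorems.MirrorDomination.abs_cov_le_of_axisMirror G r hβ0 hR hRL
        hmirror hq hq' x y k hk
    have hsqrt : Real.sqrt b = a := by rw [hb, Real.sqrt_sq ha0]
    have key := H2 β hβ₂ L R b hR hRL hb0 hpairs (m + 2) q x hq (by omega) hsep
    calc |torusE G r β L (fun U => ∏ i, (plane G r (q i) (x i) U - torusE G r β L (plane G r (q i) (x i))))|
        ≤ (C₂ * ((m + 2 : ℕ) : ℝ) ^ θ * Real.sqrt b) ^ (m + 2) := key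
      _ = (C₂ * C₁ * ((m + 2 : ℕ) : ℝ) ^ θ / (R : ℝ) ^ 4 * (((R : ℝ) * s)⁻¹) ^ σ) ^ (m + 2) := by
          rw [hsqrt, ha]; ring

/-- by-name edge (σ = 0): the canonical axis-mirror ceiling of route `SquareRootCeilings` (stmt-QuantumFields-26791)
gives the slack mirror ceiling. -/
theorem slackMirrorCeiling_of_axisMirror
    (hA : Summit.QuantumFields.YangMills.Theses.SquareRootCeilings.AxisMirrorCeiling) :
    Summit.QuantumFields.YangMills.Theses.SlackWindow.SlackMirrorCeiling := by
  intro G _ _ _ _ hG hSU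
  letI : MeasurableSpace G := borel G
  haveI : BorelSpace G := ⟨rfl⟩
  intro r v f g h Λ₅
  obtain ⟨ε₀, hε₀, hA1⟩ := hA G hG hSU r v f g h Λ₅
  refine ⟨ε₀, hε₀, fun ε hε hεε hfl => ?_⟩
  obtain ⟨C, ℓ₄, β₄, hℓ₄, hC, hA2⟩ := hA1 ε hε hεε hfl
  refine ⟨0, C, ℓ₄, β₄, hℓ₄, hC, fun β hβ s hs hs1 hsub L q R t hq hR hRs hRL ht htL => ?_⟩
  simpa using hA2 β hβ s hs hs1 hsub L q 0 R t hq hR hRs hRL ht htL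

end Summit.QuantumFields.YangMills.Theorems.SlackWindow

end
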